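import Summits.HodgeConjecture.HodgeConjecture.Theorems.SixfoldTableXCensusSimpleRows
import Literature.AlgebraicGeometry.HodgeTheory.GenericAbelianSixfoldPowersHodgeClasses
import HarnessLib

/-!
# TABLE X (dimension 6) — row 1 `g6.I(1)` (`End⁰(A) = ℚ`), ALL MEMBERS: the census nodes X2 / X1 DISCHARGED IN THE KERNEL
# on the whole isogeny class, NO displayed hypothesis, and the Hodge conjecture for every such sixfold, its powers and their
# isogeny classes — `Hg = Sp₁₂` is now a tree theorem (cell `pub-hodgeav-hg6`, req-37 (A) Q2b; eng-2 g6, lead g2 01:04:43Z (b))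

HONEST FRAMING. HC, `HC_AV` (stmt-1333), `HC_CM` (stmt-3052) and the rung H2 are NOT proved and do not occur here. The
census nodes `TableX.SixfoldCodimTwoCensus` (X2) / `TableX.SixfoldCodimThreeCensus` (X1) of `SixfoldTableXCover` are OURS
(`@[conjecture]`), never asserted — they quantify over ALL off-residue sixfolds; here they are DISCHARGED on one isogeny
class per hypothesis set. KERNEL ONLY: theorems over existing declarations; no definition, no `sorry`, no named fact, no
displayed Lie hypothesis; typed ≠ proved.

WHY THIS MODULE (census-node self-audit, axis A7 «a row VERIFIED in the kernel, not by dossier», continued). L10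
(`SixfoldTableXCensusSimpleRows`, eng-5 g3) put the simple type-I / type-II rows 2, 3, 4, 6 on A7 and recorded, under «WHAT IS
NOT COVERED», row 1 `g6.I(1)` (`End⁰ = ℚ`): «the tree has the row only modulo the NAMED print fact `Tankeev1996_…` of
`Ring2AtlasEndTrivialSixfoldRows`, and that fact yields algebraicity, not `B = D`». That is no longer so: the cell's
rank-twelve programme (eng-2 lineage g4–g6: N4 · N11 · R1–R4 · S/C/T/A · N5/twin-eight; `mem_hodgeLieC_of_skew_rankTwelve`,
`Motives/HodgeLieWeightOneRankTwelveLeviThree`, classification-free) gives `Lie Hg ⊗ ℂ = 𝔰𝔭₁₂` for every effective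
polarized weight-one Hodge structure with `End_Hdg = ℚ` and `dim_ℚ V = 12`; the Θ-subalgebra form
(`Motives/HodgeThetaSubalgebraSymplecticRankTwelveHodge`) and the `AVSlots` assembly
(`HodgeTheory/GenericAbelianSixfoldPowersHodgeClasses`, the verbatim `10 ↦ 12` port of the fivefold file) turn it into
`AbelianVariety.isDivisorGenerated_of_sixfold_endRankOne`: **`B•(B) = D•(B) ⊗ ℂ` for EVERY complex abelian sixfold `B` with
`End⁰(B) = ℚ` and for all its powers, UNCONDITIONALLY** (in print: Tankeev 1996 Thm. 1.1 first case = Gordon 1997 Thm. 10.8,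
`6 ∉ Ex(1)`; MZ99 (1.8)). THIS FILE is L10's §1 pattern applied to that theorem — nothing of L10 / L8 / L7 is restated, only
applied:
* §1 `isSimple_of_finrank_endAlgebra_eq_one` — `End⁰(B) = ℚ` ⟹ `B` simple (a one-dimensional `ℚ`-algebra is a division
  algebra; `AbelianVariety.isSimple_of_forall_exists_mul_eq_one`, Mumford §19 Cor. 2): the nodes' DOMAIN needs simplicity.
* §2 `census_of_isIsogenous_sixfold_endRankOne` — both census conclusions X2-at-`A`, X1-at-`A` at every `A ∼ B`
  (`SimpleRows.census_of_isIsogenous_of_isDivisorGenerated`); `hodgeConjectureFor_of_isIsogenous_sixfold_endRankOne` —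
  L6's CONCLUSION `HodgeConjectureFor` on the whole isogeny class (on `B` and its powers it is
  `hodgeConjectureFor_powSucc_of_sixfold_endRankOne` by name).
* §3 **`census_row1_generic`** — TABLE X row 1 `g6.I(1)`, ALL MEMBERS, KERNEL VERDICT: `dim B = 6`, `dim_ℚ End⁰(B) = 1`;
  every `A ∼ B` is IN THE NODES' DOMAIN (`dim A = 6 ∧ ¬ 𝒞 A`: `B` simple by §1 and not of CM type since `1 < 12`, L10
  `offResidueSix_of_isIsogenous_of_isSimple_of_not_isOfCMType`) AND satisfies X2-at-`A` ∧ X1-at-`A`; `census_row1_generic_self`.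
* §4 the atlas row of `Ring2AtlasEndTrivialSixfoldRows` WITHOUT its binder: `hcOnClass_simpleSixfold_endRankOne`,
  `hcOnClass_isogenousPowSucc_simpleSixfold_endRankOne`, `hodgeConjectureFor_of_prod_isIsogenous_powSucc_simpleSixfold`
  — the class targets that generation 20 stated modulo `(hT : Tankeev1996_hodgeClassesAlgebraic_powers_simple_endRankOne_notEx1)`,
  now with `hT` DISCHARGED for the row (the named fact itself, for all non-exceptional dimensions, stays a named fact).

READING (honest scope). «All members of TABLE X row 1»: every complex abelian sixfold with `dim_ℚ End⁰ = 1` (type I(1) in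
MZ99's notation; simplicity is a consequence, §1), with no general-position proviso — `Hg = Sp₁₂` holds for each of them as
a kernel theorem. Rows 2–6 (real ∕ quaternion multiplication) are L10 ∕ `Ring2AtlasTypeIIRows`; type IV and CM rows are
other modules. HC ∕ HC_AV are NOT proved beyond this isogeny-class statement's own content; X2 ∕ X1 stay `@[conjecture]`
globally. No inhabitant is exhibited and none is invented here (the tree holds no existence record for a sixfold with
`End = ℤ`). All declarations live in the sub-namespace `TableX.TypeIRows` (lead g2 DEDUP RULE). Nothing here is a
corollary of `HC_CM`; typed ≠ proved.
-/

set_option linter.dupNamespace false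

noncomputable section

open CategoryTheory
open Literature.AlgebraicGeometry Literature.AlgebraicGeometry.Motives
open Literature.AlgebraicGeometry.Motives.AbelianVariety (IsIsogenous IsSimple isSimple_of_forall_exists_mul_eq_one)
open Literature.AlgebraicGeometry.HodgeTheory
open Literature.AlgebraicGeometry.Milne1999
open Literature.AlgebraicTopology.SingularHomology
open Literature.Barriers.HodgeConjecture
open Summit.HodgeConjecture.HodgeConjecture.Ring2.ClassTargets
open Summit.HodgeConjecture.HodgeConjecture.Ring2.Motiv (ProdCMCell)
open Summit.HodgeConjecture.HodgeConjecture.Ring2.Atlas (IsQuarticFieldTypeIVFourfold)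
open Summit.HodgeConjecture.HodgeConjecture.TableX.SimpleRows

namespace Summit.HodgeConjecture.HodgeConjecture.TableX.TypeIRows

/-! ## §1 `End⁰(B) = ℚ` forces simplicity -/

/-- **A complex abelian variety with `dim_ℚ End⁰(B) = 1` is simple**: a one-dimensional `ℚ`-algebra is `ℚ · 1`, so every
non-zero element `x = c · 1` (`c ≠ 0`) has the inverse `c⁻¹ · 1`, and an abelian variety whose endomorphism algebra is a
division algebra is simple (`AbelianVariety.isSimple_of_forall_exists_mul_eq_one`, Mumford §19 Cor. 2 of Thm. 1: `End⁰` of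
a non-simple variety has zero divisors). [cite: MumfordAV1970, §19 Thm. 1 Cor. 2 (p. 174)] -/
theorem isSimple_of_finrank_endAlgebra_eq_one {B : AbelianVariety ℂ} (h1 : Module.finrank ℚ B.endAlgebra = 1) :
    B.IsSimple := by
  refine isSimple_of_forall_exists_mul_eq_one fun x hx => ?_
  -- `1 ≠ 0` in `End⁰(B)`: otherwise every element vanishes
  have h10 : (1 : B.endAlgebra) ≠ 0 := by
    intro h
    apply hx
    rw [← mul_one x, h, mul_zero]
  -- explicit instance arguments: the two `AddCommMonoid` paths on `End⁰(B)` (`Algebra.TensorProduct.instRing`) are not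
  -- identified by instance search (see `Motives/AbelianVarietyEndAlgebraInstances`)
  obtain ⟨c, hc⟩ :=
    (@finrank_eq_one_iff_of_nonzero' ℚ B.endAlgebra _ Ring.toAddCommGroup Algebra.toModule 1 h10).1 h1 x
  have hx' : x = algebraMap ℚ B.endAlgebra c := by rw [Algebra.algebraMap_eq_smul_one, hc]
  have hc0 : c ≠ 0 := by
    rintro rfl
    exact hx (by rw [hx', map_zero])
  exact ⟨algebraMap ℚ B.endAlgebra c⁻¹, by rw [hx', ← map_mul, mul_inv_cancel₀ hc0, map_one]⟩

/-- **`dim_ℚ End⁰(B) = 1 < 12 = 2 dim B` excludes CM type** (L10 `not_isOfCMType_of_finrank_endAlgebra_lt_two_mul_dim`).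
[cite: Milne1999, §2 p. 54] -/
theorem not_isOfCMType_of_sixfold_endRankOne {B : AbelianVariety ℂ} (h1 : Module.finrank ℚ B.endAlgebra = 1)
    (hdim : B.dim = 6) : ¬ IsOfCMType B :=
  not_isOfCMType_of_finrank_endAlgebra_lt_two_mul_dim (by rw [h1, hdim]; norm_num)

/-! ## §2 Row 1: both census conclusions and `HodgeConjectureFor` on the isogeny class -/

/-- **Both census conclusions X2-at-`A`, X1-at-`A` at every `A` isogenous to a complex abelian sixfold `B` with
`End⁰(B) = ℚ`** (`dim_ℚ End⁰(B) = 1`, `dim B = 6`): `B•(B) = D•(B) ⊗ ℂ` (`AbelianVariety.isDivisorGenerated_of_sixfold_endRankOne`,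
the rank-twelve programme: `Hg(B) = Sp₁₂`) and the divisor summand alone, transported along the isogeny (L10
`SimpleRows.census_of_isIsogenous_of_isDivisorGenerated` over L8). HC ∕ HC_AV NOT proved; X2 ∕ X1 stay `@[conjecture]`
globally. [cite: Tankeev1996, Thm. 1.1 (first case)] [cite: Gordon1997, Thm. 10.8] [cite: MoonenZarhin1999LowDim, §1 (1.8) and §5 (5.1)]
[cite: vanGeemen1994HodgeAV, §2.4–2.5 and Lemma 3.7] -/
theorem census_of_isIsogenous_sixfold_endRankOne {A B : AbelianVariety ℂ} (h1 : Module.finrank ℚ B.endAlgebra = 1)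
    (hdim : B.dim = 6) (hAB : IsIsogenous A B) :
    (∀ c : complexBetti A.X (2 * 2), IsRationalClass c → IsOfHodgeType A.dim A.X (2 * 2) 2 2 c →
      c ∈ divisorClassesSpan A.X A.dim 2 ⊔ Submodule.span ℂ {w' : complexBetti A.X (2 * 2) |
        ∃ (C : AbelianVariety ℂ) (g : A.X ⟶ C.X) (w : complexBetti C.X (2 * 2)), C.dim < A.dim ∧
          IsRationalClass w ∧ IsOfHodgeType C.dim C.X (2 * 2) 2 2 w ∧ w' = complexBetti.map g (2 * 2) w}) ∧
    (∀ c : complexBetti A.X (2 * 3), IsRationalClass c → IsOfHodgeType A.dim A.X (2 * 3) 3 3 c →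
      c ∈ divisorClassesSpan A.X A.dim 3 ⊔ Submodule.span ℂ {w' : complexBetti A.X (2 * 3) |
          ∃ (a : complexBetti A.X (2 * 2)) (b : complexBetti A.X (2 * 1)),
            IsRationalClass a ∧ IsOfHodgeType A.dim A.X (2 * 2) 2 2 a ∧ IsRationalClass b ∧
            IsOfHodgeType A.dim A.X (2 * 1) 1 1 b ∧ w' = cupProduct (two_mul_add_two_mul 2 1) a b} ⊔
        Submodule.span ℂ {w' : complexBetti A.X (2 * 3) |
          ∃ (C : AbelianVariety ℂ) (g : A.X ⟶ C.X) (w : complexBetti C.X (2 * 3)), C.dim < A.dim ∧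
            IsRationalClass w ∧ IsOfHodgeType C.dim C.X (2 * 3) 3 3 w ∧ w' = complexBetti.map g (2 * 3) w} ⊔
        Submodule.span ℂ {w' : complexBetti A.X (2 * 3) |
          ∃ (B' : AbelianVariety ℂ) (g : A.X ⟶ B'.X) (d : ℕ) (ψ : B' ⟶ B') (w : complexBetti B'.X (2 * 3)),
            B'.dim = 6 ∧ 0 < d ∧ ψ ≫ ψ = -(d • 𝟙 B') ∧ IsRationalClass w ∧
            IsOfHodgeType B'.dim B'.X (2 * 3) 3 3 w ∧ w ∈ weilClassesOf B' ψ 3 d ∧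
            w' = complexBetti.map g (2 * 3) w}) :=
  census_of_isIsogenous_of_isDivisorGenerated hAB (AbelianVariety.isDivisorGenerated_of_sixfold_endRankOne B h1 hdim)

/-- **L6's CONCLUSION on the isogeny class, UNCONDITIONAL: the Hodge conjecture holds for every complex abelian variety
isogenous to a sixfold `B` with `End⁰(B) = ℚ`** (`hodgeConjectureFor_of_sixfold_endRankOne` transported by van Geemen's
Lemma 3.7, `HodgeConjectureFor.of_isIsogenous`; for `A ∼ B^{N+1}` it is `hodgeConjectureFor_of_isIsogenous_powSucc_of_sixfold_endRankOne`
by name). None of Markman₄ / Markman₆ / R-W6 / X2 / X1 / `HC_CM` enters. HC ∕ HC_AV NOT proved beyond this statement's own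
content. [cite: Tankeev1996, Thm. 1.1 (first case)] [cite: Gordon1997, Thm. 10.8] [cite: MoonenZarhin1999LowDim, §1 (1.7)–(1.8)]
[cite: vanGeemen1994HodgeAV, Lemma 3.7] -/
theorem hodgeConjectureFor_of_isIsogenous_sixfold_endRankOne {A B : AbelianVariety ℂ}
    (h1 : Module.finrank ℚ B.endAlgebra = 1) (hdim : B.dim = 6) (hAB : IsIsogenous A B) :
    HodgeConjectureFor A.dim A.X :=
  HodgeConjectureFor.of_isIsogenous hAB (hodgeConjectureFor_of_sixfold_endRankOne B h1 hdim)

/-! ## §3 TABLE X row 1 `g6.I(1)`, ALL MEMBERS: kernel verdict with domain membership -/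

/-- **TABLE X ROW 1 `g6.I(1)`, ALL MEMBERS — KERNEL VERDICT on the whole isogeny class, no displayed hypothesis.** For a
complex abelian sixfold `B` with `End⁰(B) = ℚ` (`dim_ℚ End⁰(B) = 1`, `dim B = 6`) and every `A` isogenous to `B`:
`dim A = 6` and `A` is OFF the residue class `𝒞` — `B` is simple (§1) and not of CM type (`1 < 12`), so `A` is in the domain
of the census nodes (L10 `offResidueSix_of_isIsogenous_of_isSimple_of_not_isOfCMType`) —, AND both census conclusions
X2-at-`A`, X1-at-`A` hold (§2). With this theorem TABLE X row 1 leaves the theorem-less floor for EVERY member: `Hg = Sp₁₂`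
is a kernel theorem (MZ99's type I(1) in dimension 6; Tankeev 1996 Thm. 1.1 / Gordon 10.8 in print). HC ∕ HC_AV NOT proved;
X2 ∕ X1 stay `@[conjecture]` globally. [cite: Tankeev1996, Thm. 1.1 (first case)] [cite: Gordon1997, Thm. 10.8]
[cite: MoonenZarhin1999LowDim, §1 (1.8), §2 (2.3) and §5 (5.1)] [cite: vanGeemen1994HodgeAV, Lemma 3.7]
[cite: MumfordAV1970, §19 Thm. 1 Cor. 2 (p. 174)] [cite: Milne1999, §2 p. 54] -/
theorem census_row1_generic {A B : AbelianVariety ℂ} (h1 : Module.finrank ℚ B.endAlgebra = 1) (hdim : B.dim = 6)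
    (hAB : IsIsogenous A B) :
    (A.dim = 6 ∧ ¬ (IsOfCMType A ∨ ProdCMCell IsQuarticFieldTypeIVFourfold (fun Z ↦ Z.dim = 2) A)) ∧
    (∀ c : complexBetti A.X (2 * 2), IsRationalClass c → IsOfHodgeType A.dim A.X (2 * 2) 2 2 c →
      c ∈ divisorClassesSpan A.X A.dim 2 ⊔ Submodule.span ℂ {w' : complexBetti A.X (2 * 2) |
        ∃ (C : AbelianVariety ℂ) (g : A.X ⟶ C.X) (w : complexBetti C.X (2 * 2)), C.dim < A.dim ∧
          IsRationalClass w ∧ IsOfHodgeType C.dim C.X (2 * 2) 2 2 w ∧ w' = complexBetti.map g (2 * 2) w}) ∧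
    (∀ c : complexBetti A.X (2 * 3), IsRationalClass c → IsOfHodgeType A.dim A.X (2 * 3) 3 3 c →
      c ∈ divisorClassesSpan A.X A.dim 3 ⊔ Submodule.span ℂ {w' : complexBetti A.X (2 * 3) |
          ∃ (a : complexBetti A.X (2 * 2)) (b : complexBetti A.X (2 * 1)),
            IsRationalClass a ∧ IsOfHodgeType A.dim A.X (2 * 2) 2 2 a ∧ IsRationalClass b ∧
            IsOfHodgeType A.dim A.X (2 * 1) 1 1 b ∧ w' = cupProduct (two_mul_add_two_mul 2 1) a b} ⊔
        Submodule.span ℂ {w' : complexBetti A.X (2 * 3) |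
          ∃ (C : AbelianVariety ℂ) (g : A.X ⟶ C.X) (w : complexBetti C.X (2 * 3)), C.dim < A.dim ∧
            IsRationalClass w ∧ IsOfHodgeType C.dim C.X (2 * 3) 3 3 w ∧ w' = complexBetti.map g (2 * 3) w} ⊔
        Submodule.span ℂ {w' : complexBetti A.X (2 * 3) |
          ∃ (B' : AbelianVariety ℂ) (g : A.X ⟶ B'.X) (d : ℕ) (ψ : B' ⟶ B') (w : complexBetti B'.X (2 * 3)),
            B'.dim = 6 ∧ 0 < d ∧ ψ ≫ ψ = -(d • 𝟙 B') ∧ IsRationalClass w ∧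
            IsOfHodgeType B'.dim B'.X (2 * 3) 3 3 w ∧ w ∈ weilClassesOf B' ψ 3 d ∧
            w' = complexBetti.map g (2 * 3) w}) :=
  ⟨offResidueSix_of_isIsogenous_of_isSimple_of_not_isOfCMType hAB hdim (isSimple_of_finrank_endAlgebra_eq_one h1)
      (not_isOfCMType_of_sixfold_endRankOne h1 hdim),
    census_of_isIsogenous_sixfold_endRankOne h1 hdim hAB⟩

/-- **Row 1, the model itself**: a complex abelian sixfold `B` with `End⁰(B) = ℚ` is in the nodes' domain and satisfies
X2-at-`B` ∧ X1-at-`B`, no displayed hypothesis (the case `A = B` of `census_row1_generic`). HC ∕ HC_AV NOT proved.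
[cite: Tankeev1996, Thm. 1.1 (first case)] [cite: MoonenZarhin1999LowDim, §1 (1.8) and §2 (2.3)] -/
theorem census_row1_generic_self {B : AbelianVariety ℂ} (h1 : Module.finrank ℚ B.endAlgebra = 1) (hdim : B.dim = 6) :
    (B.dim = 6 ∧ ¬ (IsOfCMType B ∨ ProdCMCell IsQuarticFieldTypeIVFourfold (fun Z ↦ Z.dim = 2) B)) ∧
    (∀ c : complexBetti B.X (2 * 2), IsRationalClass c → IsOfHodgeType B.dim B.X (2 * 2) 2 2 c →
      c ∈ divisorClassesSpan B.X B.dim 2 ⊔ Submodule.span ℂ {w' : complexBetti B.X (2 * 2) |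
        ∃ (C : AbelianVariety ℂ) (g : B.X ⟶ C.X) (w : complexBetti C.X (2 * 2)), C.dim < B.dim ∧
          IsRationalClass w ∧ IsOfHodgeType C.dim C.X (2 * 2) 2 2 w ∧ w' = complexBetti.map g (2 * 2) w}) ∧
    (∀ c : complexBetti B.X (2 * 3), IsRationalClass c → IsOfHodgeType B.dim B.X (2 * 3) 3 3 c →
      c ∈ divisorClassesSpan B.X B.dim 3 ⊔ Submodule.span ℂ {w' : complexBetti B.X (2 * 3) |
          ∃ (a : complexBetti B.X (2 * 2)) (b : complexBetti B.X (2 * 1)),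
            IsRationalClass a ∧ IsOfHodgeType B.dim B.X (2 * 2) 2 2 a ∧ IsRationalClass b ∧
            IsOfHodgeType B.dim B.X (2 * 1) 1 1 b ∧ w' = cupProduct (two_mul_add_two_mul 2 1) a b} ⊔
        Submodule.span ℂ {w' : complexBetti B.X (2 * 3) |
          ∃ (C : AbelianVariety ℂ) (g : B.X ⟶ C.X) (w : complexBetti C.X (2 * 3)), C.dim < B.dim ∧
            IsRationalClass w ∧ IsOfHodgeType C.dim C.X (2 * 3) 3 3 w ∧ w' = complexBetti.map g (2 * 3) w} ⊔
        Submodule.span ℂ {w' : complexBetti B.X (2 * 3) |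
          ∃ (B' : AbelianVariety ℂ) (g : B.X ⟶ B'.X) (d : ℕ) (ψ : B' ⟶ B') (w : complexBetti B'.X (2 * 3)),
            B'.dim = 6 ∧ 0 < d ∧ ψ ≫ ψ = -(d • 𝟙 B') ∧ IsRationalClass w ∧
            IsOfHodgeType B'.dim B'.X (2 * 3) 3 3 w ∧ w ∈ weilClassesOf B' ψ 3 d ∧
            w' = complexBetti.map g (2 * 3) w}) :=
  census_row1_generic h1 hdim (IsIsogenous.refl B)

/-! ## §4 The atlas row `g6.I(1)` of `Ring2AtlasEndTrivialSixfoldRows` with its binder DISCHARGED -/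

/-- **ATLAS ROW `g6.I(1)` as a class target, UNCONDITIONAL**: `HCOnClass (dim A = 6 ∧ A simple ∧ dim_ℚ End⁰(A) = 1)` —
the binder-free twin of `Ring2.Atlas.hcOnClass_simpleSixfold_endRankOne_of_tankeev1996` (generation 20 stated the row
modulo `(hT : Tankeev1996_hodgeClassesAlgebraic_powers_simple_endRankOne_notEx1)`; the dim-6 slice of that print fact is
now `hodgeClasses_algebraic_powSucc_of_sixfold_endRankOne`). The simplicity conjunct is redundant (§1) but kept for the
verbatim class. HC ∕ HC_AV NOT proved. [cite: Tankeev1996, Thm. 1.1 (first case)] [cite: Gordon1997, Thm. 10.8] [cite: Deligne2000, §1] -/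
theorem hcOnClass_simpleSixfold_endRankOne :
    HCOnClass fun A ↦ A.dim = 6 ∧ A.IsSimple ∧ Module.finrank ℚ A.endAlgebra = 1 :=
  fun A hA ↦ hodgeConjectureFor_of_sixfold_endRankOne A hA.2.2 hA.1

/-- **… together with everything isogenous to a POWER of such a sixfold** (the isotypic cells `X ∼ Aᵏ`, `dim X = 6k`),
UNCONDITIONAL — binder-free twin of `Ring2.Atlas.hcOnClass_isogenousPowSucc_simpleSixfold_endRankOne_of_tankeev1996`.
[cite: Tankeev1996, Thm. 1.1 (first case)] [cite: vanGeemen1994HodgeAV, Lemma 3.7] -/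
theorem hcOnClass_isogenousPowSucc_simpleSixfold_endRankOne :
    HCOnClass fun X ↦ ∃ (A : AbelianVariety ℂ) (N : ℕ), A.dim = 6 ∧ A.IsSimple ∧
      Module.finrank ℚ A.endAlgebra = 1 ∧ AbelianVariety.IsIsogenous X (A.powSucc N) := by
  rintro X ⟨A, N, hA, -, h1, hX⟩
  exact hodgeConjectureFor_of_isIsogenous_powSucc_of_sixfold_endRankOne h1 hA hX

/-- **FACTOR form for the row, UNCONDITIONAL**: abelian subvarieties (up to isogeny, with a complement) of a power of a
sixfold with `End(A) = ℤ` have the Hodge property (`hodgeConjectureFor_left_of_prod`) — binder-free twin of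
`Ring2.Atlas.hodgeConjectureFor_of_prod_isIsogenous_powSucc_simpleSixfold_of_tankeev1996`.
[cite: Tankeev1996, Thm. 1.1 (first case)] [cite: vanGeemen1994HodgeAV, Lemma 3.7] -/
theorem hodgeConjectureFor_of_prod_isIsogenous_powSucc_simpleSixfold (X Y : AbelianVariety ℂ)
    {A : AbelianVariety ℂ} (hA : A.dim = 6) (h1 : Module.finrank ℚ A.endAlgebra = 1) (N : ℕ)
    (hXY : AbelianVariety.IsIsogenous (X.prod Y) (A.powSucc N)) : HodgeConjectureFor X.dim X.X :=
  hodgeConjectureFor_left_of_prod X Y (hodgeConjectureFor_of_isIsogenous_powSucc_of_sixfold_endRankOne h1 hA hXY)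

end Summit.HodgeConjecture.HodgeConjecture.TableX.TypeIRows

end
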